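import Summits.QuantumFields.YangMills.Theorems.BalabanUVNodesN21BoxObstacleAgmonDecay

/-!
# N21 (NE7c) · the AGMON DECAY LETTERS for the block obstacle problem: finite range with geometric weights, and the
# printed regime of exponentially decaying entries (lens Card 87 ∕ ROW P⁗, second half)

R134 seat pub-ymgap-dag-n21-d (g8), node N21 = NE7c (single-run shell-weight bound, NOT PRINTED in [Bałaban 1983–89],
NOT proved), lane K3⁷ `SpineGivenEndpointR13SepCoPH` (stmt-QuantumFields-20544, `--kind proof --supports … --as helper`).
Part 36 of the comparison series.  THIS FILE = §A (second half: `slow_of_depth`, ★ `agmon_decay_finiteRange`, ★ `agmon_decay_expEntries`) of the lens's `Sketch-nearmiss-g30.lean` (LENS-nearmiss v30.0 ROW P⁗, confirmed v31.0; first refusal dag-n21-d) — farm rc 0 · 0 warnings at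
the lens desk — VERBATIM, statements and proofs, re-homed in this namespace (§A split in two files for the 400-line rule).
AUTHORSHIP OF THE MATHEMATICS: planner seat `ym-lens-BalabanUVNodes-nearmiss` g30 (memo-only seat, cannot file); this seat only files.
Imports part 35 (`agmon_absorb`, `agmonBoundary_le[_kernel]`, `energy_le_of_competitor`, …).

WHAT (lens Card 87, the one displayed inequality in two regimes).  FINITE RANGE with geometric weights (`slow_of_depth`,
★ `agmon_decay_finiteRange`: `γ·q^{2d(x₀)}·e_{x₀}² ≤ q^{2r}·Γ₁·‖e‖₂²` whenever `(q^r − 1)²Γ₁ ≤ γ`) and the printed regime of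
EXPONENTIALLY DECAYING ENTRIES (★ `agmon_decay_expEntries`: `γ·e^{2αρ(x₀)}·e_{x₀}² ≤ e^{2αw}·Γ₂·‖e‖₂²` from the two weighted
row sums `Σ_y|A_xy|(αℓ)²e^{αℓ} ≤ γ`, `Σ_y|A_xy|e^{2αℓ} ≤ Γ₂`, via the in-tree Agmon-weight oscillation lemma
`BIJ85AgmonDefect.sq_exp_sub_exp_le_of_abs_le`) — the core reading of the A-projected centre's correction (parts 32–34).

HONEST FRAMING.  [textbook] finite sums ∕ linear algebra (cites the tree's `BIJ85AgmonDefect.sq_exp_sub_exp_le_of_abs_le`); 0 def, 0 sorry;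
located letters (γ, Γ₁, Γ₂, α, w) are HYPOTHESES; nothing of Bałaban's asserted; NE7c NOT PRINTED ∕ NOT proved; N21 NOT
discharged; counts unmoved (typed 28∕28 · discharged 5∕27); count-neutral; one finite 𝕋⁴ at fixed ε — nothing about ℝ⁴ ∕ OS ∕
mass gap ∕ Clay.
-/

open Set Matrix
open Literature.MathematicalPhysics.QuantumFieldTheory.BalabanImbrieJaffe1984to88 (BIJ85AgmonDefect.sq_exp_sub_exp_le_of_abs_le)
open Literature.MathematicalPhysics.QuantumFieldTheory.Balaban1983to89 (T4ShellMeasure.SlotAntiConcentration T4ShellMeasure.shell_eq_preimage)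

namespace Summit.QuantumFields.YangMills.Theorems.N21BoxObstacleAgmonDecayLetters

open Summit.QuantumFields.YangMills.Theorems.N21BoxObstacleAgmonDecay

/-! ## §A (continued)  Card 87 — the decay letters: finite range and exponentially decaying entries -/
section Absorb

variable {κ : Type*} [Fintype κ]

/-- **GEOMETRIC WEIGHTS ARE SLOWLY VARYING ACROSS A FINITE RANGE.**  `q ≥ 1`, depths within `r` of each other:
`(q^a − q^b)² ≤ (q^r − 1)²·q^a·q^b`. [textbook] -/
theorem slow_of_depth {q : ℝ} (hq : 1 ≤ q) {a b r : ℕ} (hab : a ≤ b + r) (hba : b ≤ a + r) :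
    (q ^ a - q ^ b) ^ 2 ≤ (q ^ r - 1) ^ 2 * (q ^ a * q ^ b) := by
  wlog h : a ≤ b generalizing a b
  · have h' : b ≤ a := (not_le.1 h).le
    have := this hba hab h'
    rw [← neg_sub, neg_sq, mul_comm (q ^ b) (q ^ a)] at this
    exact this
  obtain ⟨k, rfl⟩ := Nat.exists_eq_add_of_le h
  have hk : k ≤ r := by omega
  have hqa : 0 < q ^ a := pow_pos (by linarith) a
  have hqk1 : 1 ≤ q ^ k := one_le_pow₀ hq
  have hqkr : q ^ k ≤ q ^ r := pow_le_pow_right₀ hq hk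
  have hqr1 : 1 ≤ q ^ r := one_le_pow₀ hq
  rw [pow_add]
  have h1 : (q ^ a - q ^ a * q ^ k) ^ 2 = (q ^ a) ^ 2 * (q ^ k - 1) ^ 2 := by ring
  have h2 : (q ^ r - 1) ^ 2 * (q ^ a * (q ^ a * q ^ k)) = (q ^ a) ^ 2 * ((q ^ r - 1) ^ 2 * q ^ k) := by ring
  rw [h1, h2]
  refine mul_le_mul_of_nonneg_left ?_ (sq_nonneg _)
  have h3 : (q ^ k - 1) ^ 2 ≤ (q ^ r - 1) ^ 2 :=
    pow_le_pow_left₀ (by linarith) (by linarith) 2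
  calc (q ^ k - 1) ^ 2 ≤ (q ^ r - 1) ^ 2 := h3
    _ = (q ^ r - 1) ^ 2 * 1 := by ring
    _ ≤ (q ^ r - 1) ^ 2 * q ^ k := mul_le_mul_of_nonneg_left hqk1 (sq_nonneg _)

/-- ★ **THE POINTWISE DECAY LETTER FOR A FINITE-RANGE COERCIVE FORM (box obstacle problem, NO maximum principle).**
`A` symmetric with rows of `|A|` summing to `≤ Γ₁` and range `r` in a depth function `d` (`A_xy ≠ 0 ⇒ |d x − d y| ≤ r`);
`e` satisfies the Caccioppoli inequality of the box problem for every weight vanishing on the depth-zero sites (g29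
`weightedEnergy_le_comm` + ℓ²-coercivity `γ`, displayed as `hCacc`); `q ≥ 1` with `(q^r − 1)²Γ₁ ≤ γ`.  Then at every
site of positive depth `γ·q^{2d(x₀)}·e_{x₀}² ≤ q^{2r}·Γ₁·‖e‖₂²` — i.e. `|e_{x₀}| ≤ q^{r − d(x₀)}√(Γ₁∕γ)‖e‖₂`, and with
`energy_le_of_competitor` `|e_{x₀}| ≤ q^{r−d(x₀)}(Γ₁∕γ)(Σ_{J}M²)^{1∕2}`: the core reading of the projected centre.
[textbook: Agmon ∕ Combes–Thomas on a lattice] -/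
theorem agmon_decay_finiteRange (A : Matrix κ κ ℝ) (hA : A.IsSymm) {γ Γ₁ q : ℝ} (hγ0 : 0 < γ)
    (hΓ : ∀ x, ∑ y, |A x y| ≤ Γ₁) (d : κ → ℕ) (r : ℕ)
    (hrange : ∀ x y, A x y ≠ 0 → d x ≤ d y + r)
    (e : κ → ℝ)
    (hCacc : ∀ η : κ → ℝ, (∀ b, η b ≠ 0 → d b ≠ 0) →
      γ * ∑ x, (η x * e x) ^ 2 ≤ 1 / 2 * ∑ x, ∑ y, |A x y| * (|e x| * |e y|) * (η x - η y) ^ 2)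
    (hq : 1 ≤ q) (hqγ : (q ^ r - 1) ^ 2 * Γ₁ ≤ γ) (x₀ : κ) (hx₀ : d x₀ ≠ 0) :
    γ * (q ^ d x₀) ^ 2 * e x₀ ^ 2 ≤ (q ^ r) ^ 2 * Γ₁ * ∑ x, e x ^ 2 := by
  classical
  set η : κ → ℝ := fun x => if d x = 0 then 0 else q ^ d x with hη
  have hqpos : 0 < q := by linarith
  have hηd : ∀ b, η b ≠ 0 → d b ≠ 0 := by
    intro b hb h0; apply hb; simp [hη, h0]
  have hη0 : ∀ b, η b = 0 ↔ d b = 0 := by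
    intro b
    refine ⟨fun h => ?_, fun h => by simp [hη, h]⟩
    by_contra hd
    have : η b = q ^ d b := by simp [hη, hd]
    rw [this] at h
    exact absurd h (pow_ne_zero _ hqpos.ne')
  have hΓ0 : 0 ≤ Γ₁ := (Finset.sum_nonneg fun y _ => abs_nonneg (A x₀ y)).trans (hΓ x₀)
  -- interior relation and slowly-varying bound
  let R : κ → κ → Prop := fun x y => d x ≠ 0 ∧ d y ≠ 0
  have hRs : ∀ x y, R x y → R y x := fun x y h => ⟨h.2, h.1⟩
  have hslow : ∀ x y, R x y → A x y ≠ 0 →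
      (η x - η y) ^ 2 ≤ (q ^ r - 1) ^ 2 * (η x * η y) := by
    intro x y hR hA0
    have hx : η x = q ^ d x := by simp [hη, hR.1]
    have hy : η y = q ^ d y := by simp [hη, hR.2]
    rw [hx, hy]
    have h1 := hrange x y hA0
    have h2 := hrange y x ((hA.apply x y).trans_ne hA0)
    exact slow_of_depth hq h1 h2
  -- absorb (with ω = (q^r-1)² on interacting pairs; pairs with A = 0 contribute nothing either way)
  have habs := agmon_absorb A hA e η (hCacc η hηd) (fun x y => R x y ∧ A x y ≠ 0)
    (fun x y h => ⟨hRs x y h.1, (hA.apply x y).trans_ne h.2⟩)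
    (fun _ _ => (q ^ r - 1) ^ 2) (fun _ _ => rfl) (fun _ _ => sq_nonneg _)
    (fun x y h => hslow x y h.1 h.2)
    (fun x => by
      calc ∑ y, (if R x y ∧ A x y ≠ 0 then |A x y| * (q ^ r - 1) ^ 2 else 0)
          ≤ ∑ y, |A x y| * (q ^ r - 1) ^ 2 := by
            refine Finset.sum_le_sum fun y _ => ?_
            split_ifs
            · exact le_rfl
            · positivity
        _ = (q ^ r - 1) ^ 2 * ∑ y, |A x y| := by rw [Finset.mul_sum]; exact Finset.sum_congr rfl fun y _ => by ring
        _ ≤ (q ^ r - 1) ^ 2 * Γ₁ := mul_le_mul_of_nonneg_left (hΓ x) (sq_nonneg _)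
        _ ≤ γ := hqγ)
  -- boundary
  have hbd := agmonBoundary_le A hA e η (fun x y => R x y ∧ A x y ≠ 0) (H := q ^ r) (Γ₁ := Γ₁)
    (fun x y hR hA0 => by
      by_cases hx : d x = 0
      · exact Or.inl ((hη0 x).2 hx)
      by_cases hy : d y = 0
      · exact Or.inr ((hη0 y).2 hy)
      exact absurd ⟨⟨hx, hy⟩, hA0⟩ hR)
    (fun x y hA0 hy0 => by
      have hdy : d y = 0 := (hη0 y).1 hy0
      have hdx : d x ≤ r := by have := hrange x y hA0; omega
      by_cases hx : d x = 0
      · rw [(hη0 x).2 hx, abs_zero]; positivity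
      · have : η x = q ^ d x := by simp [hη, hx]
        rw [this, abs_of_pos (pow_pos hqpos _)]
        exact pow_le_pow_right₀ hq hdx)
    hΓ
  -- pointwise
  have hx0 : η x₀ = q ^ d x₀ := by simp [hη, hx₀]
  have hsingle : (η x₀ * e x₀) ^ 2 ≤ ∑ x, (η x * e x) ^ 2 :=
    Finset.single_le_sum (fun x _ => sq_nonneg (η x * e x)) (Finset.mem_univ x₀)
  have : γ * (q ^ d x₀) ^ 2 * e x₀ ^ 2 = γ * (η x₀ * e x₀) ^ 2 := by rw [hx0]; ring
  rw [this]
  calc γ * (η x₀ * e x₀) ^ 2 ≤ γ * ∑ x, (η x * e x) ^ 2 := mul_le_mul_of_nonneg_left hsingle hγ0.le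
    _ ≤ _ := habs
    _ ≤ (q ^ r) ^ 2 * Γ₁ * ∑ x, e x ^ 2 := hbd


/-- ★ **THE POINTWISE DECAY LETTER FOR EXPONENTIALLY DECAYING ENTRIES (the printed regime: `|A_xy| ≤ Γ₀e^{−δ|x−y|}`).**
`ρ` a depth function, `ℓ`-Lipschitz for a symmetric «distance» `ℓ` (`ρ x ≤ ρ y + ℓ(x,y)`), at most `w` on the zero
set `Z` (⊇ the violated letters); `e` satisfies the `ℓ²`-Caccioppoli inequality for every weight vanishing on `Z`;
the two WEIGHTED ROW SUMS `Σ_y|A_xy|(αℓ)²e^{αℓ} ≤ γ` (absorption — small for `α ≪ δ`) and `Σ_y|A_xy|e^{2αℓ} ≤ Γ₂`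
(boundary — finite for `2α < δ`).  Then off `Z`: `γ·e^{2αρ(x₀)}·e_{x₀}² ≤ e^{2αw}·Γ₂·‖e‖₂²`, i.e.
`|e_{x₀}| ≤ e^{−α(ρ(x₀) − w)}√(Γ₂∕γ)‖e‖₂` — the core-reading letter of Card 86 step (v), now a theorem.  Uses the
in-tree Agmon-weight oscillation lemma `BIJ85AgmonDefect.sq_exp_sub_exp_le_of_abs_le`. [textbook: Agmon ∕ Combes–Thomas] -/
theorem agmon_decay_expEntries (A : Matrix κ κ ℝ) (hA : A.IsSymm) {γ Γ₂ α w : ℝ} (hγ0 : 0 < γ) (hα : 0 ≤ α)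
    (Z : κ → Prop) [DecidablePred Z] (ρ : κ → ℝ) (ℓ : κ → κ → ℝ) (hℓs : ∀ x y, ℓ x y = ℓ y x)
    (hlip : ∀ x y, ρ x ≤ ρ y + ℓ x y) (hρZ : ∀ y, Z y → ρ y ≤ w)
    (e : κ → ℝ)
    (hCacc : ∀ η : κ → ℝ, (∀ b, η b ≠ 0 → ¬ Z b) →
      γ * ∑ x, (η x * e x) ^ 2 ≤ 1 / 2 * ∑ x, ∑ y, |A x y| * (|e x| * |e y|) * (η x - η y) ^ 2)
    (hS : ∀ x, ∑ y, |A x y| * ((α * ℓ x y) ^ 2 * Real.exp (α * ℓ x y)) ≤ γ)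
    (hB : ∀ x, ∑ y, |A x y| * Real.exp (2 * α * ℓ x y) ≤ Γ₂)
    (x₀ : κ) (hx₀ : ¬ Z x₀) :
    γ * Real.exp (α * ρ x₀) ^ 2 * e x₀ ^ 2 ≤ Real.exp (α * w) ^ 2 * Γ₂ * ∑ x, e x ^ 2 := by
  classical
  set η : κ → ℝ := fun x => if Z x then 0 else Real.exp (α * ρ x) with hη
  have hηZ : ∀ b, η b ≠ 0 → ¬ Z b := by
    intro b hb hZ; apply hb; simp [hη, hZ]
  have hℓabs : ∀ x y, |α * ρ x - α * ρ y| ≤ α * ℓ x y := by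
    intro x y
    rw [← mul_sub, abs_mul, abs_of_nonneg hα]
    refine mul_le_mul_of_nonneg_left (abs_sub_le_iff.2 ⟨?_, ?_⟩) hα
    · linarith [hlip x y]
    · linarith [hlip y x, hℓs x y]
  -- interior relation: both ends off `Z`
  let R : κ → κ → Prop := fun x y => ¬ Z x ∧ ¬ Z y
  have habs := agmon_absorb A hA e η (hCacc η hηZ) R (fun x y h => ⟨h.2, h.1⟩)
    (fun x y => (α * ℓ x y) ^ 2 * Real.exp (α * ℓ x y)) (fun x y => by rw [hℓs x y])
    (fun x y => by positivity)
    (fun x y hR => by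
      have hx : η x = Real.exp (α * ρ x) := by simp [hη, hR.1]
      have hy : η y = Real.exp (α * ρ y) := by simp [hη, hR.2]
      rw [hx, hy]
      exact BIJ85AgmonDefect.sq_exp_sub_exp_le_of_abs_le (hℓabs x y))
    (fun x => by
      calc ∑ y, (if R x y then |A x y| * ((α * ℓ x y) ^ 2 * Real.exp (α * ℓ x y)) else 0)
          ≤ ∑ y, |A x y| * ((α * ℓ x y) ^ 2 * Real.exp (α * ℓ x y)) := by
            refine Finset.sum_le_sum fun y _ => ?_
            split_ifs
            · exact le_rfl
            · positivity
        _ ≤ γ := hS x)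
  -- boundary, kernel form with `B = |A| e^{2αℓ}` and `H = e^{αw}`
  have hbdry : ∀ x y, ¬ Z x → Z y → (η x - η y) ^ 2 ≤ Real.exp (α * w) ^ 2 * Real.exp (2 * α * ℓ x y) := by
    intro x y hx hy
    have hx' : η x = Real.exp (α * ρ x) := by simp [hη, hx]
    have hy' : η y = 0 := by simp [hη, hy]
    rw [hx', hy', sub_zero, ← Real.exp_nat_mul, ← Real.exp_nat_mul, ← Real.exp_add, Real.exp_le_exp]
    push_cast
    have := hρZ y hy
    nlinarith [hlip x y]
  have hbd := agmonBoundary_le_kernel A e η R (H := Real.exp (α * w)) (Γ₂ := Γ₂)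
    (fun x y => |A x y| * Real.exp (2 * α * ℓ x y))
    (fun x y => by rw [hA.apply y x, hℓs x y]) (fun x y => by positivity) hB
    (fun x y hR => by
      by_cases hx : Z x
      · by_cases hy : Z y
        · have hx' : η x = 0 := by simp [hη, hx]
          have hy' : η y = 0 := by simp [hη, hy]
          rw [hx', hy', sub_zero, zero_pow two_ne_zero, mul_zero]
          positivity
        · have h := hbdry y x hy hx
          rw [← neg_sub, neg_sq] at h
          calc |A x y| * (η x - η y) ^ 2 ≤ |A x y| * (Real.exp (α * w) ^ 2 * Real.exp (2 * α * ℓ y x)) :=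
                mul_le_mul_of_nonneg_left h (abs_nonneg _)
            _ = Real.exp (α * w) ^ 2 * (|A x y| * Real.exp (2 * α * ℓ x y)) := by rw [hℓs y x]; ring
      · by_cases hy : Z y
        · have h := hbdry x y hx hy
          calc |A x y| * (η x - η y) ^ 2 ≤ |A x y| * (Real.exp (α * w) ^ 2 * Real.exp (2 * α * ℓ x y)) :=
                mul_le_mul_of_nonneg_left h (abs_nonneg _)
            _ = Real.exp (α * w) ^ 2 * (|A x y| * Real.exp (2 * α * ℓ x y)) := by ring
        · exact absurd ⟨hx, hy⟩ hR)
  -- pointwise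
  have hx0 : η x₀ = Real.exp (α * ρ x₀) := by simp [hη, hx₀]
  have hsingle : (η x₀ * e x₀) ^ 2 ≤ ∑ x, (η x * e x) ^ 2 :=
    Finset.single_le_sum (fun x _ => sq_nonneg (η x * e x)) (Finset.mem_univ x₀)
  have : γ * Real.exp (α * ρ x₀) ^ 2 * e x₀ ^ 2 = γ * (η x₀ * e x₀) ^ 2 := by rw [hx0]; ring
  rw [this]
  calc γ * (η x₀ * e x₀) ^ 2 ≤ γ * ∑ x, (η x * e x) ^ 2 := mul_le_mul_of_nonneg_left hsingle hγ0.le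
    _ ≤ _ := habs
    _ ≤ Real.exp (α * w) ^ 2 * Γ₂ * ∑ x, e x ^ 2 := hbd

end Absorb

end Summit.QuantumFields.YangMills.Theorems.N21BoxObstacleAgmonDecayLetters
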